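import Mathlib
import Summits.Ventures.PercRepro2.HCov
import Summits.Ventures.PercRepro2.PinnedLaw
import Summits.Ventures.PercRepro2.OneEdge
import Summits.Ventures.PercRepro2.HCovPinnedPoly

/-!
# The pinned-line theorem: `Gc ≡ 0` on every pinned line (blind cell PercRepro2, typer-1; mine-a g3
MINE-A.md §16 (c) "on every PINNED line (all edges but `e` at 0/1 — a two-point law under `Q`)
`G ≡ 0` — n = 5 exhaustive: 1,526,400 lines, 1,526,400 with `G ≡ 0`"; lead g11 13:50:52Z "worth a
Lean statement")

**`Gc_eq_zero_of_pinned`**: if every edge but `e` has weight `0` or `1`, then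
`CovForm.Gc p ends o a₁ a₂ a₃ b = 0` — for every value of `p e`, every graph and every marking.

Proof. Under such a `p` the law is the two-point law `(1 − t) δ_{ω₀} + t δ_{ω₁}` with `ω₁ = ω₀[e ↦ open]`
(`Pinned.prob_eq_two_point`), so every probability in `Gc` is affine in `t = p e` with `{0,1}`
coefficients given by the connection indicators `c_{ab} = 1[a ↔ b]` at `ω₀` and `ω₁`
(`Gc_eq_gcTwo`). Opening one edge moves the indicators in exactly three ways
(`OneEdge.conn_update_true_cases`): `e` joins `C(a₁)` to `C(a₂)` (then every `Q`-atom vanishes at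
`ω₁` and the gap too), or `C(a₁)` absorbs vertices joined to neither root while `C(a₂)` is unchanged,
or the mirror. In each case the resulting polynomial in `t` is identically `0` — a finite
verification over the admissible indicator patterns (`gcTwo_eq_zero_C`, `gcTwo_eq_zero_L`,
`gcTwo_eq_zero_H`; mine-a's "with two types only, both covariances are `t(1−t)·ΔΔ` and cancel").
-/

namespace Summit.Ventures.PercRepro2

namespace PinnedLine

open CovForm UnionCluster Pinned OneEdge

open scoped Classical

/-! ## Connection indicators -/

section Indicators

variable {V : Type*} {E : Type*} {R : Type*} [CommRing R]

variable (ends : E → Sym2 V)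

/-- The connection indicator `1[a ↔ b]`. -/
noncomputable def cInd (a b : V) (ω : Config E) : R := if Conn ends ω a b then 1 else 0

variable {ends}

/-- `cInd` is symmetric. -/
lemma cInd_comm (a b : V) (ω : Config E) : (cInd ends a b ω : R) = cInd ends b a ω := by
  unfold cInd
  by_cases h : Conn ends ω a b
  · rw [if_pos h, if_pos (conn_symm h)]
  · rw [if_neg h, if_neg (fun h' => h (conn_symm h'))]

/-- The indicator of `{a ↔ b}`. -/
lemma ind_connEvent (a b : V) (ω : Config E) :
    (connEvent ends a b).indicator (1 : Config E → R) ω = cInd ends a b ω := by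
  unfold cInd
  by_cases h : Conn ends ω a b
  · rw [Set.indicator_of_mem (show ω ∈ connEvent ends a b from h), if_pos h]; rfl
  · rw [Set.indicator_of_notMem (show ω ∉ connEvent ends a b from h), if_neg h]

/-- The indicator of `{a₂ ↮ a₁}`. -/
lemma ind_avoidAll (a₁ a₂ : V) (ω : Config E) :
    (avoidAll ends a₂ {a₁}).indicator (1 : Config E → R) ω = 1 - cInd ends a₁ a₂ ω := by
  unfold cInd
  by_cases h : Conn ends ω a₁ a₂
  · rw [Set.indicator_of_notMem, if_pos h]
    · ring
    · intro h'
      exact h' a₁ (Finset.mem_singleton_self a₁) (conn_symm h)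
  · rw [Set.indicator_of_mem, if_neg h]
    · simp
    · intro x hx
      rw [Finset.mem_singleton] at hx
      subst hx
      exact fun h' => h (conn_symm h')

/-- The indicator of a complement. -/
lemma ind_compl (A : Set (Config E)) (ω : Config E) :
    Aᶜ.indicator (1 : Config E → R) ω = 1 - A.indicator 1 ω := by
  by_cases h : ω ∈ A
  · rw [Set.indicator_of_mem h, Set.indicator_of_notMem (show ω ∉ Aᶜ from fun h' => h' h)]; simp
  · rw [Set.indicator_of_notMem h, Set.indicator_of_mem (show ω ∈ Aᶜ from h)]; simp

/-- The indicator of a union. -/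
lemma ind_union (A B : Set (Config E)) (ω : Config E) :
    (A ∪ B).indicator (1 : Config E → R) ω =
      A.indicator 1 ω + B.indicator 1 ω - A.indicator 1 ω * B.indicator 1 ω := by
  by_cases hA : ω ∈ A <;> by_cases hB : ω ∈ B <;> simp [hA, hB]

end Indicators

/-! ## The theorem -/

section Main

variable {V : Type*} {E : Type*} [Fintype E] [DecidableEq E] {R : Type*}
  [Field R] [LinearOrder R] [IsStrictOrderedRing R]

variable (p : E → R) (ends : E → Sym2 V) (o a₁ a₂ a₃ b : V)

/-- `ω₀ = pinnedConfig (p[e ↦ 0])`. -/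
noncomputable def w0 (e : E) : Config E := pinnedConfig (Function.update p e 0)

/-- `ω₁ = ω₀[e ↦ open]`. -/
noncomputable def w1 (e : E) : Config E := Function.update (w0 p e) e true

omit [LinearOrder R] [IsStrictOrderedRing R] in
/-- The two-point law in `mix` form. -/
lemma prob_eq_mix {e : E} (hp : ∀ e', e' ≠ e → p e' = 0 ∨ p e' = 1) (A : Set (Config E)) :
    prob p A = mix (p e) (A.indicator 1 (w0 p e)) (A.indicator 1 (w1 p e)) := by
  rw [prob_eq_two_point hp A]; rfl

section Atoms

variable {e : E} (hp : ∀ e', e' ≠ e → p e' = 0 ∨ p e' = 1)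
include hp

omit [LinearOrder R] [IsStrictOrderedRing R] in
/-- `P(Q)` on the line. -/
lemma probQ_eq : prob p (avoidAll ends a₂ {a₁}) =
    mix (p e) (1 - cInd ends a₁ a₂ (w0 p e)) (1 - cInd ends a₁ a₂ (w1 p e)) := by
  rw [prob_eq_mix p hp, ind_avoidAll, ind_avoidAll]

omit [LinearOrder R] [IsStrictOrderedRing R] in
/-- `D = P(PD)` on the line. -/
lemma probPD_eq : prob p (PDEvent ends a₁ a₂ a₃) =
    mix (p e) (aD (cInd ends a₁ a₂ (w0 p e)) (cInd ends a₁ a₃ (w0 p e)) (cInd ends a₂ a₃ (w0 p e)))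
      (aD (cInd ends a₁ a₂ (w1 p e)) (cInd ends a₁ a₃ (w1 p e)) (cInd ends a₂ a₃ (w1 p e))) := by
  rw [prob_eq_mix p hp]
  simp only [PDEvent, Dtilde, inU, indicator_inter_one, ind_compl, ind_union, ind_connEvent,
    cInd_comm a₃ a₁, cInd_comm a₃ a₂, mix, aD]
  ring

omit [LinearOrder R] [IsStrictOrderedRing R] in
/-- `gap` on the line. -/
lemma gap_eq : gap p ends a₁ a₂ b =
    mix (p e) (cInd ends a₂ b (w0 p e) - cInd ends a₁ b (w0 p e))
      (cInd ends a₂ b (w1 p e) - cInd ends a₁ b (w1 p e)) := by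
  simp only [gap, prob_eq_mix p hp, ind_connEvent, mix]
  ring

omit [LinearOrder R] [IsStrictOrderedRing R] in
/-- `E_Q[σ_b σ_o]` on the line. -/
lemma EQbo_eq : EQbo p ends o a₁ a₂ b =
    mix (p e) (aEQbo (cInd ends a₁ a₂ (w0 p e)) (cInd ends a₁ o (w0 p e)) (cInd ends a₂ o (w0 p e))
        (cInd ends a₁ b (w0 p e)) (cInd ends a₂ b (w0 p e)))
      (aEQbo (cInd ends a₁ a₂ (w1 p e)) (cInd ends a₁ o (w1 p e)) (cInd ends a₂ o (w1 p e))
        (cInd ends a₁ b (w1 p e)) (cInd ends a₂ b (w1 p e))) := by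
  simp only [EQbo, prob_eq_mix p hp, indicator_inter_one, ind_connEvent, ind_avoidAll, mix, aEQbo]
  ring

omit [LinearOrder R] [IsStrictOrderedRing R] in
/-- `E_Q[σ_b σ₃]` on the line. -/
lemma EQb3_eq : EQb3 p ends a₁ a₂ a₃ b =
    mix (p e) (aEQb3 (cInd ends a₁ a₂ (w0 p e)) (cInd ends a₁ b (w0 p e)) (cInd ends a₂ b (w0 p e))
        (cInd ends a₁ a₃ (w0 p e)) (cInd ends a₂ a₃ (w0 p e)))
      (aEQb3 (cInd ends a₁ a₂ (w1 p e)) (cInd ends a₁ b (w1 p e)) (cInd ends a₂ b (w1 p e))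
        (cInd ends a₁ a₃ (w1 p e)) (cInd ends a₂ a₃ (w1 p e))) := by
  simp only [EQb3, TEvent, prob_eq_mix p hp, indicator_inter_one, ind_compl, ind_connEvent,
    cInd_comm a₂ a₁, mix, aEQb3, aTp, aT]
  ring

omit [LinearOrder R] [IsStrictOrderedRing R] in
/-- `E_Q[σ_b σ₃ 1_{o∈U}]` on the line. -/
lemma EQb3o_eq : EQb3o p ends o a₁ a₂ a₃ b =
    mix (p e) (aEQb3o (cInd ends a₁ a₂ (w0 p e)) (cInd ends a₁ o (w0 p e)) (cInd ends a₂ o (w0 p e))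
        (cInd ends a₁ b (w0 p e)) (cInd ends a₂ b (w0 p e)) (cInd ends a₁ a₃ (w0 p e))
        (cInd ends a₂ a₃ (w0 p e)))
      (aEQb3o (cInd ends a₁ a₂ (w1 p e)) (cInd ends a₁ o (w1 p e)) (cInd ends a₂ o (w1 p e))
        (cInd ends a₁ b (w1 p e)) (cInd ends a₂ b (w1 p e)) (cInd ends a₁ a₃ (w1 p e))
        (cInd ends a₂ a₃ (w1 p e))) := by
  simp only [EQb3o, TEvent, prob_eq_mix p hp, indicator_inter_one, ind_compl, ind_connEvent,
    cInd_comm a₂ a₁, mix, aEQb3o, aTp, aT]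
  ring

omit [LinearOrder R] [IsStrictOrderedRing R] in
/-- `E_Q[σ_o]` on the line. -/
lemma EQo_eq : EQo p ends o a₁ a₂ =
    mix (p e) (aEQo (cInd ends a₁ a₂ (w0 p e)) (cInd ends a₁ o (w0 p e)) (cInd ends a₂ o (w0 p e)))
      (aEQo (cInd ends a₁ a₂ (w1 p e)) (cInd ends a₁ o (w1 p e)) (cInd ends a₂ o (w1 p e))) := by
  simp only [EQo, prob_eq_mix p hp, indicator_inter_one, ind_connEvent, ind_avoidAll, mix, aEQo]
  ring

omit [LinearOrder R] [IsStrictOrderedRing R] in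
/-- `E_Q[σ₃]` on the line. -/
lemma EQ3_eq : EQ3 p ends a₁ a₂ a₃ =
    mix (p e) (aEQ3 (cInd ends a₁ a₂ (w0 p e)) (cInd ends a₁ a₃ (w0 p e)) (cInd ends a₂ a₃ (w0 p e)))
      (aEQ3 (cInd ends a₁ a₂ (w1 p e)) (cInd ends a₁ a₃ (w1 p e)) (cInd ends a₂ a₃ (w1 p e))) := by
  simp only [EQ3, TEvent, prob_eq_mix p hp, indicator_inter_one, ind_compl, ind_connEvent,
    cInd_comm a₂ a₁, mix, aEQ3, aTp, aT]
  ring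

omit [LinearOrder R] [IsStrictOrderedRing R] in
/-- `E_Q[σ₃ 1_{o∈U}]` on the line. -/
lemma EQ3o_eq : EQ3o p ends o a₁ a₂ a₃ =
    mix (p e) (aEQ3o (cInd ends a₁ a₂ (w0 p e)) (cInd ends a₁ o (w0 p e)) (cInd ends a₂ o (w0 p e))
        (cInd ends a₁ a₃ (w0 p e)) (cInd ends a₂ a₃ (w0 p e)))
      (aEQ3o (cInd ends a₁ a₂ (w1 p e)) (cInd ends a₁ o (w1 p e)) (cInd ends a₂ o (w1 p e))
        (cInd ends a₁ a₃ (w1 p e)) (cInd ends a₂ a₃ (w1 p e))) := by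
  simp only [EQ3o, TEvent, prob_eq_mix p hp, indicator_inter_one, ind_compl, ind_connEvent,
    cInd_comm a₂ a₁, mix, aEQ3o, aTp, aT]
  ring

omit [LinearOrder R] [IsStrictOrderedRing R] in
/-- `P(PD, b ∈ U)` on the line. -/
lemma PDb_eq : PDb p ends a₁ a₂ a₃ b =
    mix (p e) (aPDb (cInd ends a₁ a₂ (w0 p e)) (cInd ends a₁ b (w0 p e)) (cInd ends a₂ b (w0 p e))
        (cInd ends a₁ a₃ (w0 p e)) (cInd ends a₂ a₃ (w0 p e)))
      (aPDb (cInd ends a₁ a₂ (w1 p e)) (cInd ends a₁ b (w1 p e)) (cInd ends a₂ b (w1 p e))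
        (cInd ends a₁ a₃ (w1 p e)) (cInd ends a₂ a₃ (w1 p e))) := by
  simp only [PDb, PDEvent, Dtilde, inU, prob_eq_mix p hp, indicator_inter_one, ind_compl,
    ind_union, ind_connEvent, cInd_comm a₃ a₁, cInd_comm a₃ a₂, mix, aPDb, aD]
  ring

omit [LinearOrder R] [IsStrictOrderedRing R] in
/-- `P(PD, b ∈ U, o ∈ U)` on the line. -/
lemma PDbo_eq : PDbo p ends o a₁ a₂ a₃ b =
    mix (p e) (aPDbo (cInd ends a₁ a₂ (w0 p e)) (cInd ends a₁ o (w0 p e)) (cInd ends a₂ o (w0 p e))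
        (cInd ends a₁ b (w0 p e)) (cInd ends a₂ b (w0 p e)) (cInd ends a₁ a₃ (w0 p e))
        (cInd ends a₂ a₃ (w0 p e)))
      (aPDbo (cInd ends a₁ a₂ (w1 p e)) (cInd ends a₁ o (w1 p e)) (cInd ends a₂ o (w1 p e))
        (cInd ends a₁ b (w1 p e)) (cInd ends a₂ b (w1 p e)) (cInd ends a₁ a₃ (w1 p e))
        (cInd ends a₂ a₃ (w1 p e))) := by
  simp only [PDbo, PDEvent, Dtilde, inU, prob_eq_mix p hp, indicator_inter_one, ind_compl,
    ind_union, ind_connEvent, cInd_comm a₃ a₁, cInd_comm a₃ a₂, mix, aPDbo, aD]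
  ring

omit [LinearOrder R] [IsStrictOrderedRing R] in
/-- `D_o = P(PD, o ∈ U)` on the line. -/
lemma Do_eq : Do p ends o a₁ a₂ a₃ =
    mix (p e) (aDo (cInd ends a₁ a₂ (w0 p e)) (cInd ends a₁ o (w0 p e)) (cInd ends a₂ o (w0 p e))
        (cInd ends a₁ a₃ (w0 p e)) (cInd ends a₂ a₃ (w0 p e)))
      (aDo (cInd ends a₁ a₂ (w1 p e)) (cInd ends a₁ o (w1 p e)) (cInd ends a₂ o (w1 p e))
        (cInd ends a₁ a₃ (w1 p e)) (cInd ends a₂ a₃ (w1 p e))) := by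
  simp only [Do, PDEvent, Dtilde, inU, prob_eq_mix p hp, indicator_inter_one, ind_compl,
    ind_union, ind_connEvent, cInd_comm a₃ a₁, cInd_comm a₃ a₂, mix, aDo, aD]
  ring

omit [LinearOrder R] [IsStrictOrderedRing R] in
/-- **`Gc` under the two-point law is `gcTwo`** evaluated at the connection indicators of
`ω₀ = pinnedConfig (p[e ↦ 0])` and `ω₁ = ω₀[e ↦ open]`. -/
lemma Gc_eq_gcTwo :
    Gc p ends o a₁ a₂ a₃ b =
      gcTwo (p e)
        (cInd ends a₁ a₂ (w0 p e)) (cInd ends a₁ o (w0 p e)) (cInd ends a₂ o (w0 p e))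
        (cInd ends a₁ b (w0 p e)) (cInd ends a₂ b (w0 p e)) (cInd ends a₁ a₃ (w0 p e))
        (cInd ends a₂ a₃ (w0 p e))
        (cInd ends a₁ a₂ (w1 p e)) (cInd ends a₁ o (w1 p e)) (cInd ends a₂ o (w1 p e))
        (cInd ends a₁ b (w1 p e)) (cInd ends a₂ b (w1 p e)) (cInd ends a₁ a₃ (w1 p e))
        (cInd ends a₂ a₃ (w1 p e)) := by
  rw [Gc, DEF, probQ_eq p ends a₁ a₂ hp, probPD_eq p ends a₁ a₂ a₃ hp, gap_eq p ends a₁ a₂ b hp,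
    EQbo_eq p ends o a₁ a₂ b hp, EQb3_eq p ends a₁ a₂ a₃ b hp, EQb3o_eq p ends o a₁ a₂ a₃ b hp,
    EQo_eq p ends o a₁ a₂ hp, EQ3_eq p ends a₁ a₂ a₃ hp, EQ3o_eq p ends o a₁ a₂ a₃ hp,
    PDb_eq p ends a₁ a₂ a₃ b hp, PDbo_eq p ends o a₁ a₂ a₃ b hp, Do_eq p ends o a₁ a₂ a₃ hp]
  rfl

end Atoms

omit [Fintype E] [DecidableEq E] in
/-- The exclusivity of the two root clusters at a configuration with `a₁ ↮ a₂`. -/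
lemma pat0_of_not_conn {ω : Config E} (hQ : ¬ Conn ends ω a₁ a₂) (v : V) :
    Pat0 (cInd ends a₁ v ω : R) (cInd ends a₂ v ω) := by
  unfold Pat0 cInd
  by_cases h1 : Conn ends ω a₁ v <;> by_cases h2 : Conn ends ω a₂ v
  · exact absurd (conn_trans h1 (conn_symm h2)) hQ
  · simp [h1, h2]
  · simp [h1, h2]
  · simp [h1, h2]

omit [Fintype E] [DecidableEq E] in
/-- The pattern of a vertex under a one-sided growth of `C(a₁)`. -/
lemma pat_of_growth {ω ω' : Config E} (hQ : ¬ Conn ends ω a₁ a₂) (v : V)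
    (hmono : Conn ends ω a₁ v → Conn ends ω' a₁ v)
    (hnew : Conn ends ω' a₁ v → ¬ Conn ends ω a₁ v → ¬ Conn ends ω a₂ v) :
    Pat (cInd ends a₁ v ω : R) (cInd ends a₂ v ω) (cInd ends a₁ v ω') := by
  unfold Pat cInd
  by_cases h1 : Conn ends ω a₁ v <;> by_cases h2 : Conn ends ω a₂ v <;>
    by_cases h3 : Conn ends ω' a₁ v
  · exact absurd (conn_trans h1 (conn_symm h2)) hQ
  · exact absurd (conn_trans h1 (conn_symm h2)) hQ
  · simp [h1, h2, h3]
  · exact absurd (hmono h1) h3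
  · exact absurd h2 (hnew h3 h1)
  · simp [h1, h2, h3]
  · simp [h1, h2, h3]
  · simp [h1, h2, h3]

/-- **The pinned-line theorem**: if every edge but `e` is pinned to `0` or `1`, then
`Gc p ends o a₁ a₂ a₃ b = 0` (for every value of `p e`). -/
theorem Gc_eq_zero_of_pinned {e : E} (hp : ∀ e', e' ≠ e → p e' = 0 ∨ p e' = 1) :
    Gc p ends o a₁ a₂ a₃ b = 0 := by
  rw [Gc_eq_gcTwo p ends o a₁ a₂ a₃ b hp]
  have hw1 : w1 p e = Function.update (w0 p e) e true := rfl
  obtain ⟨u, w, hends⟩ : ∃ u w, ends e = s(u, w) := by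
    rcases Sym2.mk_surjective (ends e) with ⟨⟨u, w⟩, huw⟩
    exact ⟨u, w, huw.symm⟩
  by_cases hQ₁ : Conn ends (w1 p e) a₁ a₂
  · -- Case C: the two root clusters merge
    have hx1 : (cInd ends a₁ a₂ (w1 p e) : R) = 1 := by simp [cInd, hQ₁]
    have hb1 : (cInd ends a₂ b (w1 p e) : R) = cInd ends a₁ b (w1 p e) := by
      unfold cInd
      by_cases h : Conn ends (w1 p e) a₁ b
      · rw [if_pos h, if_pos (conn_trans (conn_symm hQ₁) h)]
      · rw [if_neg h, if_neg (fun h' => h (conn_trans hQ₁ h'))]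
    rw [hx1]
    refine gcTwo_eq_zero_C _ _ _ _ _ _ _ _ _ _ _ _ _ _ hb1 ?_
    by_cases hQ₀ : Conn ends (w0 p e) a₁ a₂
    · left
      refine ⟨by simp [cInd, hQ₀], ?_⟩
      unfold cInd
      by_cases h : Conn ends (w0 p e) a₁ b
      · rw [if_pos h, if_pos (conn_trans (conn_symm hQ₀) h)]
      · rw [if_neg h, if_neg (fun h' => h (conn_trans hQ₀ h'))]
    · right
      exact ⟨by simp [cInd, hQ₀], pat0_of_not_conn ends a₁ a₂ hQ₀ o,
        pat0_of_not_conn ends a₁ a₂ hQ₀ b, pat0_of_not_conn ends a₁ a₂ hQ₀ a₃⟩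
  · -- Cases L / H: one root cluster grows, the other is unchanged
    have hQ₀ : ¬ Conn ends (w0 p e) a₁ a₂ := fun h => hQ₁ (hw1 ▸ conn_mono (le_update_true _ e) h)
    have hx0 : (cInd ends a₁ a₂ (w0 p e) : R) = 0 := by simp [cInd, hQ₀]
    have hx1 : (cInd ends a₁ a₂ (w1 p e) : R) = 0 := by simp [cInd, hQ₁]
    rw [hx0, hx1]
    rw [hw1] at hQ₁ ⊢
    rcases conn_update_true_cases hends (w0 p e) hQ₁ with ⟨h2, hmono, hnew⟩ | ⟨h1, hmono, hnew⟩
    · -- `C(a₂)` unchanged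
      have e2 : ∀ v, (cInd ends a₂ v (Function.update (w0 p e) e true) : R) = cInd ends a₂ v (w0 p e) :=
        fun v => by unfold cInd; rw [h2 v]
      rw [e2 o, e2 b, e2 a₃]
      exact gcTwo_eq_zero_L _ _ _ _ _ _ _ _ _ _
        (pat_of_growth ends a₁ a₂ hQ₀ o (hmono o) (hnew o))
        (pat_of_growth ends a₁ a₂ hQ₀ b (hmono b) (hnew b))
        (pat_of_growth ends a₁ a₂ hQ₀ a₃ (hmono a₃) (hnew a₃))
    · -- `C(a₁)` unchanged
      have e1 : ∀ v, (cInd ends a₁ v (Function.update (w0 p e) e true) : R) = cInd ends a₁ v (w0 p e) :=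
        fun v => by unfold cInd; rw [h1 v]
      have hQ₀' : ¬ Conn ends (w0 p e) a₂ a₁ := fun h => hQ₀ (conn_symm h)
      rw [e1 o, e1 b, e1 a₃]
      exact gcTwo_eq_zero_H _ _ _ _ _ _ _ _ _ _
        (pat_of_growth ends a₂ a₁ hQ₀' o (hmono o) (hnew o))
        (pat_of_growth ends a₂ a₁ hQ₀' b (hmono b) (hnew b))
        (pat_of_growth ends a₂ a₁ hQ₀' a₃ (hmono a₃) (hnew a₃))

end Main

end PinnedLine

end Summit.Ventures.PercRepro2
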